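import Literature.NumberTheory.LFunctions.MatomakiRadziwillTaoMajorArc
import Literature.NumberTheory.LFunctions.MatomakiRadziwillTaoTheoremA2With
import HarnessLib

/-!
# Matomäki–Radziwiłł–Tao 2015, §4 (major arcs) re-run from Theorem A.2 with an abstract middle term

Topic `Literature/NumberTheory/LFunctions`.  Everything in this file is PROVED; there are no new definitions
and no named facts.  It is the hA2-dependent part of `MatomakiRadziwillTaoMajorArc.lean`
(`theoremA2_discrete`, `errorTerms_le`, `winL1_typical_le`, `perChar_bound`, `majorArc_le`) with the named
fact `MatomakiRadziwillTao2015_theoremA2` replaced by the hypothesis schema `MRT2015.TheoremA2With mid`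
(`MatomakiRadziwillTaoTheoremA2With.lean`): Theorem A.2 for COMPLETELY multiplicative `f` with the middle
term `mid(M)` in place of `(1 + M) e^{-M}`.  The proofs are those of the tree verbatim; what changes is
the bookkeeping of the middle term, which the major arcs see only through

  `mid` antitone on `[1, ∞)` and `≥ 0`,  and  `√(mid(κ log W - 48)) ≤ C_m W^{-5/4}` (`W ≥ W₁`),

under the non-pretentiousness hypothesis `κ log W ≤ M(g; X, W)` (`κ ≥ 3`; Matomäki–Radziwiłł–Tao have
`κ = 3`, `mid M = (1+M)e^{-M}`, `C_m = 3e^{24}`).  For the middle term `(1 + M) e^{-M/2}` that Halász's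
theorem for block-restricted sums yields (cf. `TwistedPrimeSumTail.lean`, "Remark on the regions `𝒯₀ ∪ 𝒯₁`"),
`κ = 8` works; for `e^{-M/4}`, `κ = 12`.

* `MRT2015.A2With.theoremA2_discrete` — the discrete corollary of the schema;
* `MRT2015.A2With.errorTerms_le`, `MRT2015.A2With.winL1_typical_le` — one completely multiplicative function;
* `MRT2015.A2With.perChar_bound`, `MRT2015.A2With.majorArc_le` — the major arc estimate
  `∑_{x ≤ X₃} |∑_{x < dm ≤ x+L, m ∈ 𝒮'} g(m) e(αm)| ≤ C L X₃ (W^{-2} + d^{-1} W^{-1/4})` under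
  `κ log W ≤ M(g; X, W)`.

## References
* K. Matomäki, M. Radziwiłł, T. Tao, *An averaged form of Chowla's conjecture*, Algebra & Number Theory 9
  (2015), §4 and Appendix A, Theorem A.2. [cite: MatomakiRadziwillTao2015, §4]
-/

noncomputable section

open Finset Real MeasureTheory
open scoped Classical FourierTransform

namespace Literature.NumberTheory.LFunctions

open Sieve (SieveIntervalSystem minPretentiousDistSq minPretentiousDistSq_nonneg)

namespace MRT2015

namespace A2With

open Sieve.Vinogradov

variable {η X₀ : ℝ}

/-! ### Complete multiplicativity of the character twist -/

/-- `(g χ)(m n) = (g χ)(m) (g χ)(n)` for completely multiplicative `g`. [folklore] -/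
theorem twistChar_mul {g : ArithmeticFunction ℂ} (hg : ∀ m n : ℕ, g (m * n) = g m * g n) {q : ℕ}
    (χ : DirichletCharacter ℂ q) : ∀ m n : ℕ, twistChar g χ (m * n) = twistChar g χ m * twistChar g χ n := by
  intro m n
  simp only [twistChar_apply, Nat.cast_mul, map_mul, hg]
  ring

/-- `(g χ)(1) = 1` when `g 1 = 1`. [folklore] -/
theorem twistChar_map_one {g : ArithmeticFunction ℂ} (hg1 : g 1 = 1) {q : ℕ} (χ : DirichletCharacter ℂ q) :
    twistChar g χ 1 = 1 := by
  simp [twistChar_apply, hg1]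

/-! ### The discrete corollary of the schema -/

/-- **Discrete corollary of Theorem A.2, with middle term `mid`** (from the schema `TheoremA2With mid`,
`mid ≥ 0`): under the hypotheses of
Theorem A.2 with `h = L - 1/2` (`L ≥ 4` an integer, `Q₁ ≤ L - 1/2`), the discrete mean square
over the integer windows `[k, k + L)`, `k ∈ [⌈X⌉ + 1, ⌊2X⌋]`, obeys
`∑_k |∑_{k ≤ n < k+L, n ∈ 𝒮} f(n)|² ≤ 2 C (mid(M) + (log L)^{1/3}/P₁^{1/6-η} + (log X)^{-1/50}) L² X`
(`f` completely multiplicative):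
on `x ∈ (k - 1/2, k)` the real window `[x, x + h]` has integer points `[k, k + L)`, so the sum is
at most `2 ∫_X^{2X} |∑|² dx` (the proof of `MRT2015.theoremA2_discrete` verbatim).
[cite: MatomakiRadziwillTao2015, Appendix A, Theorem A.2] -/
theorem theoremA2_discrete {mid : ℝ → ℝ} (hmid0 : ∀ M : ℝ, 0 ≤ M → 0 ≤ mid M)
    (hA2 : TheoremA2With mid) :
    ∀ η : ℝ, 0 < η → η < 1 / 6 → ∃ C Xη : ℝ, 0 ≤ C ∧ ∀ (X X₀ : ℝ) (L : ℕ)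
      (I : SieveIntervalSystem η X₀) (f : ArithmeticFunction ℂ),
      (∀ m n : ℕ, f (m * n) = f m * f n) → f 1 = 1 → (∀ n, ‖f n‖ ≤ 1) →
      Xη < X → 4 ≤ L → Real.sqrt X ≤ X₀ → X₀ ≤ X → I.Q 1 ≤ (L : ℝ) - 1 / 2 →
      ∑ k ∈ Icc (⌈X⌉₊ + 1) ⌊2 * X⌋₊, ‖windowSumA2 f I X L k‖ ^ 2 ≤
        2 * C * (mid (minPretentiousDistSq f X X) +
          Real.log L ^ (1 / 3 : ℝ) / (I.P 1) ^ (1 / 6 - η) + 1 / Real.log X ^ (1 / 50 : ℝ)) *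
          (L : ℝ) ^ 2 * X := by
  intro η hη hη'
  obtain ⟨C, Xη, hC⟩ := hA2 η hη hη'
  refine ⟨max C 0, max Xη 1, le_max_right _ _, ?_⟩
  intro X X₀ L I f hfm hfone hf1 hX hL hX₀ hX₀X hQL
  have hP1 : 1 ≤ I.P 1 := I.one_le_P_one
  have hX1 : 1 < X := lt_of_le_of_lt (le_max_right _ _) hX
  have hXη : Xη < X := lt_of_le_of_lt (le_max_left _ _) hX
  have hX0 : 0 < X := by linarith
  set h : ℝ := (L : ℝ) - 1 / 2 with hhdef
  have hL4 : (4 : ℝ) ≤ L := by exact_mod_cast hL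
  have hh3 : 3 ≤ h := by rw [hhdef]; linarith
  have hh0 : 0 < h := by linarith
  have key := hC X X₀ h I f hfm hfone hf1 hXη hh3 hX₀ hX₀X hQL
  -- the error factor
  set B : ℝ := mid (minPretentiousDistSq f X X) + Real.log h ^ (1 / 3 : ℝ) / (I.P 1) ^ (1 / 6 - η) +
    1 / Real.log X ^ (1 / 50 : ℝ) with hB
  set B' : ℝ := mid (minPretentiousDistSq f X X) + Real.log L ^ (1 / 3 : ℝ) / (I.P 1) ^ (1 / 6 - η) +
    1 / Real.log X ^ (1 / 50 : ℝ) with hB'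
  have hBB' : B ≤ B' := by
    rw [hB, hB']
    have h1 : Real.log h ^ (1 / 3 : ℝ) ≤ Real.log L ^ (1 / 3 : ℝ) :=
      Real.rpow_le_rpow (Real.log_nonneg (by linarith)) (Real.log_le_log hh0 (by rw [hhdef]; linarith))
        (by norm_num)
    have hc : 0 < (I.P 1) ^ (1 / 6 - η) := Real.rpow_pos_of_pos (by linarith) _
    have h2 := div_le_div_of_nonneg_right h1 hc.le
    linarith
  -- `B ≥ 0`
  have hBpos : 0 ≤ B := by
    rw [hB]
    have h1 : 0 ≤ mid (minPretentiousDistSq f X X) :=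
      hmid0 _ (minPretentiousDistSq_nonneg hf1 X hX0.le)
    have h2 : 0 ≤ Real.log h ^ (1 / 3 : ℝ) / (I.P 1) ^ (1 / 6 - η) :=
      div_nonneg (Real.rpow_nonneg (Real.log_nonneg (by linarith)) _) (Real.rpow_nonneg (by linarith) _)
    have h3 : 0 ≤ 1 / Real.log X ^ (1 / 50 : ℝ) := by
      have := Real.rpow_nonneg (Real.log_nonneg hX1.le) (1 / 50 : ℝ)
      positivity
    linarith
  -- rewrite the integrand: `‖h⁻¹ S‖² = h⁻² ‖S‖²`
  have hpt : ∀ x, ‖(h : ℂ)⁻¹ * shortSumA2 f I X h x‖ ^ 2 =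
      (1 / h ^ 2) * sqIntegrand f I X h x := by
    intro x
    rw [sqIntegrand, norm_mul, norm_inv, Complex.norm_real, Real.norm_eq_abs, abs_of_pos hh0,
      mul_pow, inv_pow, one_div]
  have hint : ∫ x in X..(2 * X), ‖(h : ℂ)⁻¹ * shortSumA2 f I X h x‖ ^ 2 =
      (1 / h ^ 2) * ∫ x in X..(2 * X), sqIntegrand f I X h x := by
    rw [← intervalIntegral.integral_const_mul]
    exact intervalIntegral.integral_congr fun x _ => hpt x
  rw [hint] at key
  -- so `∫ sqIntegrand ≤ C B h² X`
  have hI0 : 0 ≤ ∫ x in X..(2 * X), sqIntegrand f I X h x :=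
    intervalIntegral.integral_nonneg (by linarith) fun x _ => sqIntegrand_nonneg f I X h x
  have hint2 : ∫ x in X..(2 * X), sqIntegrand f I X h x ≤ max C 0 * B' * h ^ 2 * X := by
    have h1 : 1 / X * (1 / h ^ 2 * ∫ x in X..(2 * X), sqIntegrand f I X h x) ≤ max C 0 * B' :=
      calc _ ≤ C * B := key
        _ ≤ max C 0 * B := mul_le_mul_of_nonneg_right (le_max_left _ _) hBpos
        _ ≤ max C 0 * B' := mul_le_mul_of_nonneg_left hBB' (le_max_right _ _)
    have h2 : 1 / X * (1 / h ^ 2 * ∫ x in X..(2 * X), sqIntegrand f I X h x) =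
        (∫ x in X..(2 * X), sqIntegrand f I X h x) / (X * h ^ 2) := by
      field_simp
    rw [h2, div_le_iff₀ (by positivity)] at h1
    linarith
  -- the discrete sum is at most twice the integral over `[⌈X⌉, ⌊2X⌋] ⊆ [X, 2X]`
  have hK₁ : 1 ≤ ⌈X⌉₊ + 1 := by omega
  have hceil : ⌈X⌉₊ ≤ ⌊2 * X⌋₊ :=
    Nat.le_floor (by linarith [Nat.ceil_lt_add_one hX0.le])
  have hsum := sum_half_sq_le_integral hf1 I X (K₁ := ⌈X⌉₊ + 1) (K₂ := ⌊2 * X⌋₊) (L := L)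
    hK₁ (by omega) (by omega)
  have hsub : ∫ x in (((⌈X⌉₊ + 1 : ℕ) : ℝ) - 1)..(⌊2 * X⌋₊ : ℕ), sqIntegrand f I X h x ≤
      ∫ x in X..(2 * X), sqIntegrand f I X h x := by
    have h1 : X ≤ ((⌈X⌉₊ + 1 : ℕ) : ℝ) - 1 := by push_cast; linarith [Nat.le_ceil X]
    have h2 : ((⌊2 * X⌋₊ : ℕ) : ℝ) ≤ 2 * X := Nat.floor_le (by linarith)
    have h3 : ((⌈X⌉₊ + 1 : ℕ) : ℝ) - 1 ≤ ((⌊2 * X⌋₊ : ℕ) : ℝ) ∨ ((⌊2 * X⌋₊ : ℕ) : ℝ) < ((⌈X⌉₊ + 1 : ℕ) : ℝ) - 1 :=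
      le_or_gt _ _
    rcases h3 with h3 | h3
    · exact intervalIntegral.integral_mono_interval h1 h3 h2
        (Filter.Eventually.of_forall fun y => sqIntegrand_nonneg f I X h y)
        (intervalIntegrable_sqIntegrand hf1 I X hh0.le _ _)
    · rw [intervalIntegral.integral_of_ge h3.le]
      have : 0 ≤ ∫ x in Set.Ioc (((⌊2 * X⌋₊ : ℕ) : ℝ)) (((⌈X⌉₊ + 1 : ℕ) : ℝ) - 1), sqIntegrand f I X h x :=
        setIntegral_nonneg measurableSet_Ioc fun y _ => sqIntegrand_nonneg f I X h y
      linarith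
  have hhL : h ^ 2 ≤ (L : ℝ) ^ 2 := pow_le_pow_left₀ hh0.le (by rw [hhdef]; linarith) 2
  have hCB : 0 ≤ max C 0 * B' := mul_nonneg (le_max_right _ _) (hBpos.trans hBB')
  calc ∑ k ∈ Icc (⌈X⌉₊ + 1) ⌊2 * X⌋₊, ‖windowSumA2 f I X L k‖ ^ 2
      = 2 * ∑ k ∈ Icc (⌈X⌉₊ + 1) ⌊2 * X⌋₊, 1 / 2 * ‖windowSumA2 f I X L k‖ ^ 2 := by
        rw [Finset.mul_sum]; refine Finset.sum_congr rfl fun k _ => by ring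
    _ ≤ 2 * ∫ x in X..(2 * X), sqIntegrand f I X h x := by
        have := hsum.trans hsub
        linarith
    _ ≤ 2 * (max C 0 * B' * h ^ 2 * X) := by linarith [hint2]
    _ ≤ 2 * (max C 0 * B' * (L : ℝ) ^ 2 * X) := by
        have := mul_le_mul_of_nonneg_left hhL hCB
        nlinarith
    _ = 2 * max C 0 * B' * (L : ℝ) ^ 2 * X := by ring


/-! ### One completely multiplicative function -/

/-- **The three error terms in the regime of Theorem 2.3** (`η = 1/20`, `P₁ = W^{200}`), with an antitone
middle term `mid`: `mid(M) ≤ mid(M_low)` (`M ≥ M_low ≥ 1`),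
`(log s)^{1/3}/P₁^{7/60} ≤ W^{-5/2}` (`log s ≤ W^{1/5} + 2`), `(log X_b)^{-1/50} ≤ 2W^{-5/2}`
(`X_b ≥ √X`, `W^{125} ≤ log X`). [cite: MatomakiRadziwillTao2015, §4] -/
theorem errorTerms_le {mid : ℝ → ℝ} (hanti : ∀ a b : ℝ, 1 ≤ a → a ≤ b → mid b ≤ mid a)
    {W Mlow M ls Xb X : ℝ} (hW1 : 2 ≤ W) (hMlow : 1 ≤ Mlow) (hM : Mlow ≤ M)
    (hls0 : 0 ≤ ls) (hls : ls ≤ W ^ (1 / 5 : ℝ) + 2) (hX0 : 0 < X) (hXb : Real.sqrt X ≤ Xb)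
    (hW125 : W ^ 125 ≤ Real.log X) :
    mid M + ls ^ (1 / 3 : ℝ) / (W ^ 200) ^ (1 / 6 - 1 / 20 : ℝ) +
        1 / Real.log Xb ^ (1 / 50 : ℝ) ≤
      mid Mlow + 3 / (W ^ ((5 : ℝ) / 4) * W ^ ((5 : ℝ) / 4)) := by
  have hW0 : 0 < W := by linarith
  have hW1' : 1 ≤ W := by linarith
  have hww : W ^ ((5 : ℝ) / 4) * W ^ ((5 : ℝ) / 4) = W ^ ((5 : ℝ) / 2) := by
    rw [← Real.rpow_add hW0]; norm_num
  rw [hww]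
  have hW52 : 0 < W ^ ((5 : ℝ) / 2) := Real.rpow_pos_of_pos hW0 _
  -- (α)
  have hα : mid M ≤ mid Mlow := hanti Mlow M hMlow hM
  -- (β)
  have hβ : ls ^ (1 / 3 : ℝ) / (W ^ 200) ^ (1 / 6 - 1 / 20 : ℝ) ≤ 1 / W ^ ((5 : ℝ) / 2) := by
    -- `ls ≤ W^{1/5} + 2 ≤ 3 W^{1/5} ≤ W^2 · W^{1/5}` hence `ls^{1/3} ≤ W^{11/15}`
    have hW15 : 1 ≤ W ^ (1 / 5 : ℝ) := Real.one_le_rpow hW1' (by norm_num)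
    have hls' : ls ≤ W ^ ((11 : ℝ) / 5) := by
      calc ls ≤ W ^ (1 / 5 : ℝ) + 2 := hls
        _ ≤ 3 * W ^ (1 / 5 : ℝ) := by linarith
        _ ≤ W ^ (2 : ℝ) * W ^ (1 / 5 : ℝ) := by
            refine mul_le_mul_of_nonneg_right ?_ (by positivity)
            rw [show W ^ (2 : ℝ) = W ^ 2 by norm_num]; nlinarith
        _ = W ^ ((11 : ℝ) / 5) := by rw [← Real.rpow_add hW0]; norm_num
    have h1 : ls ^ (1 / 3 : ℝ) ≤ W ^ ((11 : ℝ) / 15) := by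
      calc ls ^ (1 / 3 : ℝ) ≤ (W ^ ((11 : ℝ) / 5)) ^ (1 / 3 : ℝ) := Real.rpow_le_rpow hls0 hls' (by norm_num)
        _ = W ^ ((11 : ℝ) / 15) := by rw [← Real.rpow_mul hW0.le]; norm_num
    have h2 : (W ^ 200 : ℝ) ^ (1 / 6 - 1 / 20 : ℝ) = W ^ ((70 : ℝ) / 3) := by
      rw [show (W ^ 200 : ℝ) = W ^ (200 : ℝ) by norm_num, ← Real.rpow_mul hW0.le]
      norm_num
    rw [h2, div_le_div_iff₀ (Real.rpow_pos_of_pos hW0 _) hW52, one_mul]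
    calc ls ^ (1 / 3 : ℝ) * W ^ ((5 : ℝ) / 2) ≤ W ^ ((11 : ℝ) / 15) * W ^ ((5 : ℝ) / 2) :=
          mul_le_mul_of_nonneg_right h1 hW52.le
      _ = W ^ ((11 : ℝ) / 15 + 5 / 2) := (Real.rpow_add hW0 _ _).symm
      _ ≤ W ^ ((70 : ℝ) / 3) := Real.rpow_le_rpow_of_exponent_le hW1' (by norm_num)
  -- (γ)
  have hγ : 1 / Real.log Xb ^ (1 / 50 : ℝ) ≤ 2 / W ^ ((5 : ℝ) / 2) := by
    have hXb0 : 0 < Xb := lt_of_lt_of_le (Real.sqrt_pos.mpr hX0) hXb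
    have hlogXb : W ^ 125 / 2 ≤ Real.log Xb := by
      have h1 : Real.log (Real.sqrt X) ≤ Real.log Xb := Real.log_le_log (Real.sqrt_pos.mpr hX0) hXb
      rw [Real.log_sqrt hX0.le] at h1
      linarith
    have hlogXb0 : 0 < Real.log Xb := lt_of_lt_of_le (by positivity) hlogXb
    have h2 : (W ^ 125 / 2 : ℝ) ^ (1 / 50 : ℝ) ≤ Real.log Xb ^ (1 / 50 : ℝ) :=
      Real.rpow_le_rpow (by positivity) hlogXb (by norm_num)
    have h3 : (W ^ 125 / 2 : ℝ) ^ (1 / 50 : ℝ) = W ^ ((5 : ℝ) / 2) / 2 ^ (1 / 50 : ℝ) := by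
      rw [Real.div_rpow (by positivity) (by norm_num), show (W ^ 125 : ℝ) = W ^ (125 : ℝ) by norm_num,
        ← Real.rpow_mul hW0.le]
      norm_num
    have h4 : (2 : ℝ) ^ (1 / 50 : ℝ) ≤ 2 := by
      calc (2 : ℝ) ^ (1 / 50 : ℝ) ≤ 2 ^ (1 : ℝ) := Real.rpow_le_rpow_of_exponent_le (by norm_num) (by norm_num)
        _ = 2 := Real.rpow_one 2
    have h5 : W ^ ((5 : ℝ) / 2) / 2 ≤ Real.log Xb ^ (1 / 50 : ℝ) := by
      calc W ^ ((5 : ℝ) / 2) / 2 ≤ W ^ ((5 : ℝ) / 2) / 2 ^ (1 / 50 : ℝ) :=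
            div_le_div_of_nonneg_left hW52.le (by positivity) h4
        _ = (W ^ 125 / 2 : ℝ) ^ (1 / 50 : ℝ) := h3.symm
        _ ≤ _ := h2
    rw [div_le_div_iff₀ (Real.rpow_pos_of_pos hlogXb0 _) hW52]
    linarith
  have e : (3 : ℝ) / W ^ ((5 : ℝ) / 2) = 1 / W ^ ((5 : ℝ) / 2) + 2 / W ^ ((5 : ℝ) / 2) := by ring
  linarith


set_option maxHeartbeats 1600000 in
/-- **The major arc estimate for a single completely multiplicative function, middle term `mid`**
([MRT2015, §4], from "The
summand vanishes unless `y ≤ X/d₁`" to the end of the section), discrete form: for `f`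
`1`-bounded multiplicative with `M(f; X_b) ≥ M_low ≥ 1` at all heights
`X₃/(4 d₁ W^{10}) ≤ X_b ≤ X`, windows of length `s ∈ [L/W³ + 1/2, 3L]`, `d₁ < W²`, and the
parameter regime of Theorem 2.3 with `W ≤ log^{1/125} X` (and `L W^{15} ≤ X`,
`L ≤ exp(√(log X / 2))`, `(log L)⁵ ≤ W`, `W^{203} ≤ L`),
`∑_{y ≤ X₃/d₁} |∑_{y < n ≤ y+s, n ∈ 𝒮'} f(n)| ≤ C s (X₃/d₁) (√(mid(M_low)) + W^{-5/4})`,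
`𝒮' = 𝒮_{W^{200}, L/W³, √X₃, X₃/d₁}`: the contribution of `y ≤ X₃/(d₁ W^{10})` is trivial, and on
each dyadic block Cauchy–Schwarz and the schema `TheoremA2With mid` (`theoremA2_discrete`, `η = 1/20`) apply,
the three error terms being `≤ mid(M_low)`, `≤ W^{-5/2}`, `≤ 2 W^{-5/2}` (`errorTerms_le`); the proof is that of
`MRT2015.winL1_typical_le` verbatim.
[cite: MatomakiRadziwillTao2015, §4] -/
theorem winL1_typical_le {mid : ℝ → ℝ} (hmid0 : ∀ M : ℝ, 0 ≤ M → 0 ≤ mid M)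
    (hanti : ∀ a b : ℝ, 1 ≤ a → a ≤ b → mid b ≤ mid a) (hA2 : TheoremA2With mid) :
    ∃ C W₀ Xs : ℝ, 0 < C ∧ ∀ (X X₃ W : ℝ) (L d₁ s : ℕ) (f : ArithmeticFunction ℂ) (Mlow : ℝ),
      (∀ m n : ℕ, f (m * n) = f m * f n) → f 1 = 1 → (∀ n, ‖f n‖ ≤ 1) →
      Xs ≤ X → X ≤ X₃ → X₃ ≤ 2 * X → W₀ ≤ W → W ≤ Real.log X ^ (1 / 125 : ℝ) →
      1 ≤ d₁ → (d₁ : ℝ) < W ^ 2 →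
      W ^ 203 ≤ (L : ℝ) → (L : ℝ) * W ^ 15 ≤ X → (L : ℝ) ≤ Real.exp (Real.sqrt (Real.log X / 2)) →
      Real.log L ^ 5 ≤ W → (L : ℝ) / W ^ 3 + 1 / 2 ≤ s → (s : ℝ) ≤ 3 * L →
      1 ≤ Mlow → (∀ Xb : ℝ, X₃ / (4 * d₁ * W ^ 10) ≤ Xb → Xb ≤ X → Mlow ≤ minPretentiousDistSq f Xb Xb) →
      winL1 (typFun f (W ^ 200) (L / W ^ 3) (Real.sqrt X₃) (X₃ / d₁)) s ⌊X₃ / d₁⌋₊ ≤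
        C * s * (X₃ / d₁) * (Real.sqrt (mid Mlow) + W ^ (-(5 : ℝ) / 4)) := by
  obtain ⟨C_A, Xη, hC_A0, hdisc⟩ := theoremA2_discrete hmid0 hA2 (1 / 20) (by norm_num) (by norm_num)
  obtain ⟨P₀, hP₀⟩ := def21_system (η := 1 / 20) (by norm_num) (by norm_num)
  refine ⟨4 * Real.sqrt C_A + 4, max 64 P₀, max (Real.exp 16) (4 * Xη ^ 2 + 4 * |Xη| + 4),
    by positivity, ?_⟩
  intro X X₃ W L d₁ s f Mlow hfm hfone hf1 hXs hXX₃ hX₃ hW₀ hWX hd₁ hd₁W hWL hLX hLexp hlogL hsL hsL' hMlow hM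
  -- basic facts
  have hW64 : (64 : ℝ) ≤ W := (le_max_left _ _).trans hW₀
  have hWP₀ : P₀ ≤ W := (le_max_right _ _).trans hW₀
  have hW1 : (1 : ℝ) ≤ W := by linarith
  have hW0 : (0 : ℝ) < W := by linarith
  have hX16 : 16 ≤ Real.log X := by
    have h := (le_max_left _ _).trans hXs
    have := Real.log_le_log (Real.exp_pos _) h
    rwa [Real.log_exp] at this
  have hX0 : 0 < X := lt_of_lt_of_le (Real.exp_pos 16) ((le_max_left _ _).trans hXs)
  have hX1 : 1 ≤ X := by
    have : (1 : ℝ) ≤ Real.exp 16 := Real.one_le_exp (by norm_num)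
    exact this.trans ((le_max_left _ _).trans hXs)
  have hXη : 4 * Xη ^ 2 + 4 * |Xη| + 4 ≤ X := (le_max_right _ _).trans hXs
  have hX₃0 : 0 < X₃ := by linarith
  have hd₁0 : (0 : ℝ) < d₁ := by exact_mod_cast hd₁
  have hd₁1 : (1 : ℝ) ≤ d₁ := by exact_mod_cast hd₁
  have hL0 : (0 : ℝ) < L := lt_of_lt_of_le (by positivity) hWL
  have hs0 : (0 : ℝ) < s := by
    have : (0 : ℝ) < (L : ℝ) / W ^ 3 := by positivity
    linarith
  set Y₁ : ℝ := X₃ / d₁ with hY₁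
  have hY₁X₃ : Y₁ ≤ X₃ := div_le_self hX₃0.le hd₁1
  have hY₁0 : 0 < Y₁ := by positivity
  -- `W^{12} ≤ log X ≤ √X / 2`
  have hlogX1 : 1 ≤ Real.log X := by linarith
  have hW125 : W ^ (125 : ℕ) ≤ Real.log X := by
    have h := Real.rpow_le_rpow hW0.le hWX (by norm_num : (0 : ℝ) ≤ 125)
    rw [← Real.rpow_mul (by linarith : (0 : ℝ) ≤ Real.log X),
      show (1 / 125 : ℝ) * 125 = 1 by norm_num, Real.rpow_one,
      show (125 : ℝ) = (125 : ℕ) by norm_num, Real.rpow_natCast] at h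
    exact h
  have hW12 : W ^ (12 : ℕ) ≤ Real.log X := le_trans (pow_le_pow_right₀ hW1 (by norm_num)) hW125
  have hsqrtX : 2 * Real.log X ≤ Real.sqrt X := two_mul_log_le_sqrt hX0 hX16
  have hY₁low : X / W ^ 2 ≤ Y₁ := by
    rw [hY₁, div_le_div_iff₀ (by positivity) hd₁0]
    nlinarith
  -- the dyadic parameters
  set I : ℕ := Nat.log 2 ⌊W ^ 10⌋₊ + 1 with hI
  have hWfloor : ⌊W ^ 10⌋₊ ≠ 0 := by
    have : (1 : ℝ) ≤ W ^ 10 := one_le_pow₀ hW1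
    exact Nat.pos_iff_ne_zero.mp (Nat.floor_pos.mpr this)
  have h2I_low : W ^ 10 < (2 : ℝ) ^ I := by
    have h1 : ⌊W ^ 10⌋₊ < 2 ^ I := Nat.lt_pow_succ_log_self one_lt_two _
    calc W ^ 10 < ⌊W ^ 10⌋₊ + 1 := Nat.lt_floor_add_one _
      _ ≤ (2 : ℝ) ^ I := by exact_mod_cast h1
  have h2I_up : (2 : ℝ) ^ I ≤ 2 * W ^ 10 := by
    have h1 : 2 ^ (I - 1) ≤ ⌊W ^ 10⌋₊ := by
      rw [hI, Nat.add_sub_cancel]; exact Nat.pow_log_le_self 2 hWfloor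
    have h2 : ((2 ^ (I - 1) : ℕ) : ℝ) ≤ W ^ 10 :=
      le_trans (by exact_mod_cast h1) (Nat.floor_le (by positivity))
    have e : (2 : ℝ) ^ I = 2 * 2 ^ (I - 1) := by
      rw [← pow_succ', Nat.sub_add_cancel (by rw [hI]; omega)]
    rw [e]; push_cast at h2; linarith
  have hIle : (I : ℝ) ≤ 2 * W ^ 10 := by
    have : (I : ℝ) < (2 : ℝ) ^ I := by exact_mod_cast Nat.lt_two_pow_self
    linarith
  set N : ℕ → ℕ := fun i => ⌊Y₁ / 2 ^ i⌋₊ with hN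
  have hN0 : N 0 = ⌊Y₁⌋₊ := by simp [hN]
  have hNanti : ∀ i, N (i + 1) ≤ N i := by
    intro i
    refine Nat.floor_le_floor ?_
    rw [pow_succ]
    exact div_le_div_of_nonneg_left hY₁0.le (by positivity) (by linarith [pow_pos (two_pos : (0:ℝ) < 2) i])
  -- heights of the blocks
  have hXb_range : ∀ i ∈ Icc 1 I, X₃ / (4 * d₁ * W ^ 10) ≤ Y₁ / 2 ^ i ∧ Y₁ / 2 ^ i ≤ X ∧
      Real.sqrt X ≤ Y₁ / 2 ^ i ∧ Real.sqrt X₃ ≤ Y₁ / 2 ^ i ∧ 2 * (Y₁ / 2 ^ i) ≤ Y₁ := by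
    intro i hi
    rw [Finset.mem_Icc] at hi
    have h2i : (2 : ℝ) ^ i ≤ 2 ^ I := pow_le_pow_right₀ (by norm_num) hi.2
    have h2i1 : (2 : ℝ) ≤ 2 ^ i := by
      calc (2 : ℝ) = 2 ^ 1 := by norm_num
        _ ≤ 2 ^ i := pow_le_pow_right₀ (by norm_num) hi.1
    have hlow : Y₁ / (2 * W ^ 10) ≤ Y₁ / 2 ^ i :=
      div_le_div_of_nonneg_left hY₁0.le (by positivity) (h2i.trans h2I_up)
    refine ⟨?_, ?_, ?_, ?_, ?_⟩
    · calc X₃ / (4 * d₁ * W ^ 10) ≤ X₃ / (2 * d₁ * W ^ 10) :=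
            div_le_div_of_nonneg_left hX₃0.le (by positivity) (by nlinarith [pow_pos hW0 10])
        _ = Y₁ / (2 * W ^ 10) := by rw [hY₁]; field_simp
        _ ≤ _ := hlow
    · calc Y₁ / 2 ^ i ≤ Y₁ / 2 := div_le_div_of_nonneg_left hY₁0.le (by norm_num) h2i1
        _ ≤ X₃ / 2 := by linarith
        _ ≤ X := by linarith
    · -- `√X ≤ X/(2W^{12}) ≤ Y₁/(2W^{10})`
      have h1 : Real.sqrt X * (2 * W ^ 12) ≤ X := by
        have hs := Real.sq_sqrt hX0.le
        have hs0 := Real.sqrt_nonneg X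
        calc Real.sqrt X * (2 * W ^ 12) ≤ Real.sqrt X * (2 * Real.log X) := by gcongr
          _ ≤ Real.sqrt X * Real.sqrt X := by gcongr
          _ = X := by rw [← sq, hs]
      have h2 : Real.sqrt X ≤ Y₁ / (2 * W ^ 10) := by
        rw [le_div_iff₀ (by positivity)]
        calc Real.sqrt X * (2 * W ^ 10) = Real.sqrt X * (2 * W ^ 12) / W ^ 2 := by
              field_simp
          _ ≤ X / W ^ 2 := div_le_div_of_nonneg_right h1 (by positivity)
          _ ≤ Y₁ := hY₁low
      exact h2.trans hlow
    · have h1 : Real.sqrt X₃ ≤ Real.sqrt (2 * X) := Real.sqrt_le_sqrt hX₃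
      have h2 : Real.sqrt (2 * X) ≤ 2 * Real.sqrt X := by
        rw [Real.sqrt_le_left (by positivity)]
        nlinarith [Real.sq_sqrt hX0.le, Real.sqrt_nonneg X]
      -- `2√X ≤ X/W^{12} ≤ Y₁ / 2^i` similarly
      have h3 : 2 * Real.sqrt X ≤ Y₁ / (2 * W ^ 10) := by
        rw [le_div_iff₀ (by positivity)]
        have h1' : Real.sqrt X * (4 * W ^ 12) ≤ X := by
          have hs := Real.sq_sqrt hX0.le
          have : 4 * W ^ 12 ≤ Real.sqrt X := by
            have hW4 : 4 * W ^ 12 ≤ 2 * Real.log X := by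
              have : 2 * W ^ 12 ≤ W ^ 13 := by nlinarith [pow_pos hW0 12]
              have h13 : W ^ (13 : ℕ) ≤ Real.log X := le_trans (pow_le_pow_right₀ hW1 (by norm_num)) hW125
              linarith
            linarith
          calc Real.sqrt X * (4 * W ^ 12) ≤ Real.sqrt X * Real.sqrt X := by gcongr
            _ = X := by rw [← sq, hs]
        calc 2 * Real.sqrt X * (2 * W ^ 10) = Real.sqrt X * (4 * W ^ 12) / W ^ 2 := by
              field_simp
              ring
          _ ≤ X / W ^ 2 := div_le_div_of_nonneg_right h1' (by positivity)
          _ ≤ Y₁ := hY₁low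
      linarith [hlow]
    · rw [show 2 * (Y₁ / 2 ^ i) = Y₁ * (2 / 2 ^ i) by ring]
      exact mul_le_of_le_one_right hY₁0.le ((div_le_one (by positivity)).mpr h2i1)
  -- parameters of Theorem A.2
  set P₁ : ℝ := W ^ 200 with hP₁
  set Q₁ : ℝ := (L : ℝ) / W ^ 3 with hQ₁
  have hP₁1 : 1 ≤ P₁ := one_le_pow₀ hW1
  have hWP₁ : W ≤ P₁ := by
    calc W = W ^ 1 := (pow_one W).symm
      _ ≤ W ^ 200 := pow_le_pow_right₀ hW1 (by norm_num)
  have hP₁Q₁ : P₁ ≤ Q₁ := by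
    rw [hQ₁, le_div_iff₀ (by positivity), hP₁, ← pow_add]; exact hWL
  have hQ₁1 : 1 ≤ Q₁ := hP₁1.trans hP₁Q₁
  have hlogL : Real.log L ≤ W ^ (1 / 5 : ℝ) := by
    have hlogL0 : 0 ≤ Real.log L := Real.log_nonneg (by exact_mod_cast Nat.one_le_iff_ne_zero.mpr (by
      rintro rfl; simp at hL0))
    have h := Real.rpow_le_rpow (by positivity) hlogL (by norm_num : (0 : ℝ) ≤ 1 / 5)
    rw [← Real.rpow_natCast, ← Real.rpow_mul hlogL0] at h
    norm_num at h
    exact h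
  have hQ₁exp : Q₁ ≤ Real.exp (Real.sqrt (Real.log (Real.sqrt X₃))) := by
    have h1 : Q₁ ≤ L := div_le_self (Nat.cast_nonneg L) (one_le_pow₀ hW1)
    refine h1.trans (hLexp.trans (Real.exp_le_exp.mpr (Real.sqrt_le_sqrt ?_)))
    rw [Real.log_sqrt hX₃0.le]
    linarith [Real.log_le_log hX0 hXX₃]
  have hcond := hP₀ P₁ Q₁ (Real.sqrt X₃) (hWP₀.trans hWP₁) hP₁Q₁ (by
    -- `(log Q₁)^{800} ≤ W^{160} ≤ W^{200}`
    have hlogQ₁ : Real.log Q₁ ≤ W ^ (1 / 5 : ℝ) :=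
      le_trans (Real.log_le_log (by positivity) (div_le_self (Nat.cast_nonneg L) (one_le_pow₀ hW1))) hlogL
    have hlogQ₁0 : 0 ≤ Real.log Q₁ := Real.log_nonneg hQ₁1
    calc Real.log Q₁ ^ (40 / (1 / 20 : ℝ)) ≤ (W ^ (1 / 5 : ℝ)) ^ (40 / (1 / 20 : ℝ)) :=
          Real.rpow_le_rpow hlogQ₁0 hlogQ₁ (by norm_num)
      _ = W ^ (160 : ℝ) := by rw [← Real.rpow_mul hW0.le]; norm_num
      _ ≤ W ^ (200 : ℝ) := Real.rpow_le_rpow_of_exponent_le hW1 (by norm_num)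
      _ = P₁ := by rw [hP₁, show (200 : ℝ) = (200 : ℕ) by norm_num, Real.rpow_natCast]) hQ₁exp
  obtain ⟨Isys, hIP, hIQ⟩ := hcond
  have hs4 : 4 ≤ s := by
    have : (4 : ℝ) ≤ s := by
      have : (4 : ℝ) ≤ (L : ℝ) / W ^ 3 := by
        rw [le_div_iff₀ (by positivity)]
        calc 4 * W ^ 3 ≤ W * W ^ 3 := by gcongr; linarith
          _ = W ^ 4 := by ring
          _ ≤ W ^ 203 := pow_le_pow_right₀ hW1 (by norm_num)
          _ ≤ L := hWL
      linarith
    exact_mod_cast this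
  have hXηlt : Xη < Real.sqrt X := by
    have h1 : (2 * |Xη| + 1) ^ 2 < X := by
      have := sq_abs Xη
      nlinarith [abs_nonneg Xη]
    have h2 : 2 * |Xη| + 1 < Real.sqrt X := by
      rw [show 2 * |Xη| + 1 = Real.sqrt ((2 * |Xη| + 1) ^ 2) by
        rw [Real.sqrt_sq (by positivity)]]
      exact Real.sqrt_lt_sqrt (by positivity) h1
    linarith [le_abs_self Xη, abs_nonneg Xη]
  -- the `W`-powers
  set w : ℝ := W ^ ((5 : ℝ) / 4) with hw
  have hw0 : 0 < w := Real.rpow_pos_of_pos hW0 _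
  have hwneg : W ^ (-(5 : ℝ) / 4) = 1 / w := by
    rw [hw, show (-(5 : ℝ) / 4) = -((5 : ℝ) / 4) by ring, Real.rpow_neg hW0.le, one_div]
  have hwW2 : w ≤ W ^ 2 := by
    rw [hw, show W ^ 2 = W ^ (2 : ℝ) by norm_num]
    exact Real.rpow_le_rpow_of_exponent_le hW1 (by norm_num)
  -- the uniform error bound
  set Bmax : ℝ := mid Mlow + 3 / (w * w) with hBmax
  have hmidMlow : 0 ≤ mid Mlow := hmid0 Mlow (by linarith)
  have hBmax0 : 0 ≤ Bmax := by positivity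
  have hlogs0 : 0 ≤ Real.log s := Real.log_nonneg (by
    have : (4 : ℝ) ≤ s := by exact_mod_cast hs4
    linarith)
  have hlogs : Real.log s ≤ W ^ (1 / 5 : ℝ) + 2 := by
    have h1 : Real.log s ≤ Real.log 3 + Real.log L := by
      rw [← Real.log_mul (by norm_num) hL0.ne']; exact Real.log_le_log hs0 hsL'
    have h2 : Real.log 3 ≤ 2 := by
      have := Real.log_le_sub_one_of_pos (show (0:ℝ) < 3 by norm_num); linarith
    linarith
  have herr : ∀ i ∈ Icc 1 I,
      mid (minPretentiousDistSq f (Y₁ / 2 ^ i) (Y₁ / 2 ^ i)) +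
        Real.log s ^ (1 / 3 : ℝ) / (Isys.P 1) ^ (1 / 6 - 1 / 20 : ℝ) +
        1 / Real.log (Y₁ / 2 ^ i) ^ (1 / 50 : ℝ) ≤ Bmax := by
    intro i hi
    obtain ⟨hXb1, hXb2, hXb3, -, -⟩ := hXb_range i hi
    rw [hIP, seqP_one, hBmax]
    exact errorTerms_le hanti (by linarith) hMlow (hM _ hXb1 hXb2) hlogs0 hlogs hX0 hXb3 hW125
  -- the A.2 bound on each block
  have hA2block : ∀ i ∈ Icc 1 I,
      ∑ k ∈ Icc (⌈Y₁ / 2 ^ i⌉₊ + 1) ⌊2 * (Y₁ / 2 ^ i)⌋₊,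
        ‖windowSumA2 f Isys (Y₁ / 2 ^ i) s k‖ ^ 2 ≤
        2 * C_A * Bmax * (s : ℝ) ^ 2 * (Y₁ / 2 ^ i) := by
    intro i hi
    obtain ⟨hXb1, hXb2, hXb3, hXb4, hXb5⟩ := hXb_range i hi
    have hXb0 : 0 ≤ Y₁ / 2 ^ i := by positivity
    have h := hdisc (Y₁ / 2 ^ i) (Real.sqrt X₃) s Isys f hfm hfone hf1
      (hXηlt.trans_le hXb3) hs4 (Real.sqrt_le_sqrt (by linarith [hY₁X₃])) hXb4
      (by rw [hIQ, seqQ_one]; linarith)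
    refine h.trans ?_
    have h1 := mul_le_mul_of_nonneg_left (herr i hi) (show 0 ≤ 2 * C_A by positivity)
    have h2 := mul_le_mul_of_nonneg_right (mul_le_mul_of_nonneg_right h1 (sq_nonneg (s : ℝ))) hXb0
    exact h2
  -- each block
  have hblock : ∀ i ∈ Icc 1 I,
      ∑ y ∈ Ioc (N i) (N (i - 1)), ‖typWin f P₁ Q₁ (Real.sqrt X₃) Y₁ s y‖ ≤
        2 * Real.sqrt (C_A * Bmax) * s * (Y₁ / 2 ^ i) + s + (s : ℝ) ^ 2 := by
    intro i hi
    obtain ⟨-, -, hXb3, -, hXb5⟩ := hXb_range i hi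
    have hi1 : 1 ≤ i := (Finset.mem_Icc.mp hi).1
    have hXb1 : 1 ≤ Y₁ / 2 ^ i := by
      have : (1 : ℝ) ≤ Real.sqrt X := by
        rw [show (1 : ℝ) = Real.sqrt 1 by simp]; exact Real.sqrt_le_sqrt hX1
      exact this.trans hXb3
    have hN2 : N (i - 1) = ⌊2 * (Y₁ / 2 ^ i)⌋₊ := by
      rw [hN]; dsimp only
      congr 1
      rw [show (2 : ℝ) ^ i = 2 ^ (i - 1) * 2 by rw [← pow_succ, Nat.sub_add_cancel hi1]]
      field_simp
    have hb := block_le hf1 Isys (by norm_num) (by norm_num) hIP hIQ hXb1 hXb5 s (hA2block i hi)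
    rw [hN2]
    refine hb.trans ?_
    have e : Real.sqrt (2 * (Y₁ / 2 ^ i)) * Real.sqrt (2 * C_A * Bmax * (s : ℝ) ^ 2 * (Y₁ / 2 ^ i)) =
        2 * Real.sqrt (C_A * Bmax) * s * (Y₁ / 2 ^ i) := by
      rw [← Real.sqrt_mul (by positivity)]
      rw [show 2 * (Y₁ / 2 ^ i) * (2 * C_A * Bmax * (s : ℝ) ^ 2 * (Y₁ / 2 ^ i)) =
        (C_A * Bmax) * (2 * s * (Y₁ / 2 ^ i)) ^ 2 by ring]
      rw [Real.sqrt_mul (by positivity), Real.sqrt_sq (by positivity)]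
      ring
    rw [e]
  -- sum of the blocks
  have hgeom : ∑ i ∈ Icc 1 I, Y₁ / 2 ^ i ≤ Y₁ := sum_div_two_pow_le hY₁0.le I
  have hblocks : ∑ i ∈ Icc 1 I, ∑ y ∈ Ioc (N i) (N (i - 1)), ‖typWin f P₁ Q₁ (Real.sqrt X₃) Y₁ s y‖ ≤
      2 * Real.sqrt (C_A * Bmax) * s * Y₁ + I * (s + (s : ℝ) ^ 2) := by
    calc ∑ i ∈ Icc 1 I, ∑ y ∈ Ioc (N i) (N (i - 1)), ‖typWin f P₁ Q₁ (Real.sqrt X₃) Y₁ s y‖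
        ≤ ∑ i ∈ Icc 1 I, (2 * Real.sqrt (C_A * Bmax) * s * (Y₁ / 2 ^ i) + s + (s : ℝ) ^ 2) :=
          Finset.sum_le_sum hblock
      _ = 2 * Real.sqrt (C_A * Bmax) * s * ∑ i ∈ Icc 1 I, Y₁ / 2 ^ i + #(Icc 1 I) * (s + (s : ℝ) ^ 2) := by
          rw [Finset.sum_add_distrib, Finset.sum_add_distrib, Finset.mul_sum, Finset.sum_const,
            Finset.sum_const, nsmul_eq_mul, nsmul_eq_mul]
          ring
      _ ≤ 2 * Real.sqrt (C_A * Bmax) * s * Y₁ + I * (s + (s : ℝ) ^ 2) := by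
          rw [Nat.card_Icc, Nat.add_sub_cancel]
          gcongr
  -- the low part
  have hlow : ∑ y ∈ range (N I + 1), ‖typWin f P₁ Q₁ (Real.sqrt X₃) Y₁ s y‖ ≤
      (Y₁ / W ^ 10 + 1) * s := by
    calc ∑ y ∈ range (N I + 1), ‖typWin f P₁ Q₁ (Real.sqrt X₃) Y₁ s y‖
        ≤ ∑ y ∈ range (N I + 1), (s : ℝ) := Finset.sum_le_sum fun y _ => norm_typWin_le hf1 _ _ _ _ s y
      _ = (N I + 1) * s := by rw [Finset.sum_const, card_range, nsmul_eq_mul]; push_cast; ring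
      _ ≤ (Y₁ / W ^ 10 + 1) * s := by
          gcongr
          calc (N I : ℝ) ≤ Y₁ / 2 ^ I := Nat.floor_le (by positivity)
            _ ≤ Y₁ / W ^ 10 := div_le_div_of_nonneg_left hY₁0.le (by positivity) h2I_low.le
  -- assemble
  have htot : winL1 (typFun f P₁ Q₁ (Real.sqrt X₃) Y₁) s ⌊Y₁⌋₊ ≤
      2 * Real.sqrt (C_A * Bmax) * s * Y₁ + I * (s + (s : ℝ) ^ 2) + (Y₁ / W ^ 10 + 1) * s := by
    unfold winL1
    simp_rw [sum_Ioc_typFun]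
    rw [← hN0, sum_range_eq_low_add_blocks _ N hNanti I]
    linarith [hblocks, hlow]
  refine htot.trans ?_
  rw [hwneg]
  have hY₁w : w ≤ Y₁ := by
    refine hwW2.trans (le_trans ?_ hY₁low)
    rw [le_div_iff₀ (by positivity)]
    calc W ^ 2 * W ^ 2 = W ^ 4 := by ring
      _ ≤ W ^ 125 := pow_le_pow_right₀ hW1 (by norm_num)
      _ ≤ Real.log X := hW125
      _ ≤ X := (Real.log_le_sub_one_of_pos hX0).trans (by linarith)
  have hsY : 4 * W ^ 12 * (s : ℝ) ≤ Y₁ := by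
    calc 4 * W ^ 12 * (s : ℝ) ≤ (12 * W ^ 12) * L := by nlinarith [pow_pos hW0 12]
      _ ≤ W ^ 13 * L := by
          have : (12 : ℝ) * W ^ 12 ≤ W ^ 13 := by nlinarith [pow_pos hW0 12]
          exact mul_le_mul_of_nonneg_right this (Nat.cast_nonneg L)
      _ = (L * W ^ 15) / W ^ 2 := by field_simp
      _ ≤ X / W ^ 2 := div_le_div_of_nonneg_right hLX (by positivity)
      _ ≤ Y₁ := hY₁low
  have hs1 : (1 : ℝ) ≤ s := by
    have : (4 : ℝ) ≤ s := by exact_mod_cast hs4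
    linarith
  have hfin := final_numerics (E := mid Mlow) hC_A0 hmidMlow hw0 hW1 hwW2 hs1
    hY₁0 hIle hY₁w hsY
  exact hfin


/-! ### The major arc estimate -/

set_option maxHeartbeats 1600000 in
/-- **The per-character input of the major arc estimate, middle term `mid`**: from `winL1_typical_le`
(in the form of its conclusion `h6`), the non-pretentiousness hypothesis `κ log W ≤ M(g; X, W)` (`κ ≥ 3`) and
the decay `√(mid(κ log W - 48)) ≤ C_m W^{-5/4}`: for
every `d₀ ≤ q ≤ W`, modulus `q₀ ≤ q`, character `χ (mod q₀)` and window length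
`s' ∈ {⌊j/d₀⌋, ⌊j/d₀⌋ + 1}` with `2L/W² < j ≤ 2L/d + 1`,
`winL1 (1_{𝒮'_{dd₀}} gχ) s' ⌊X₃/(dd₀)⌋ ≤ C₆ (C_m + 1) W^{-5/4} s' X₃/(d d₀)` (`M_low = κ log W - 48`; the proof of
`MRT2015.perChar_bound` verbatim).
[cite: MatomakiRadziwillTao2015, §4] -/
theorem perChar_bound {mid : ℝ → ℝ} {κ Cm : ℝ} (hκ : 3 ≤ κ) {C₆ W₀ Xs : ℝ} (hC₆ : 0 < C₆)
    (h6 : ∀ (X X₃ W : ℝ) (L d₁ s : ℕ) (f : ArithmeticFunction ℂ) (Mlow : ℝ),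
      (∀ m n : ℕ, f (m * n) = f m * f n) → f 1 = 1 → (∀ n, ‖f n‖ ≤ 1) →
      Xs ≤ X → X ≤ X₃ → X₃ ≤ 2 * X → W₀ ≤ W → W ≤ Real.log X ^ (1 / 125 : ℝ) →
      1 ≤ d₁ → (d₁ : ℝ) < W ^ 2 →
      W ^ 203 ≤ (L : ℝ) → (L : ℝ) * W ^ 15 ≤ X → (L : ℝ) ≤ Real.exp (Real.sqrt (Real.log X / 2)) →
      Real.log L ^ 5 ≤ W → (L : ℝ) / W ^ 3 + 1 / 2 ≤ s → (s : ℝ) ≤ 3 * L →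
      1 ≤ Mlow → (∀ Xb : ℝ, X₃ / (4 * d₁ * W ^ 10) ≤ Xb → Xb ≤ X → Mlow ≤ minPretentiousDistSq f Xb Xb) →
      winL1 (typFun f (W ^ 200) (L / W ^ 3) (Real.sqrt X₃) (X₃ / d₁)) s ⌊X₃ / d₁⌋₊ ≤
        C₆ * s * (X₃ / d₁) * (Real.sqrt (mid Mlow) + W ^ (-(5 : ℝ) / 4)))
    {X X₃ W : ℝ} {L d q j : ℕ} {g : ArithmeticFunction ℂ}
    (hg : ∀ m n : ℕ, g (m * n) = g m * g n) (hg1' : g 1 = 1) (hg1 : ∀ n, ‖g n‖ ≤ 1)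
    (hXs : Xs ≤ X) (hXX₃ : X ≤ X₃) (hX₃ : X₃ ≤ 2 * X) (hW₀ : W₀ ≤ W) (hW17 : Real.exp 17 ≤ W)
    (hWX : W ≤ Real.log X ^ (1 / 125 : ℝ)) (hd : 1 ≤ d) (hdW : (d : ℝ) < W)
    (hqW : (q : ℝ) ≤ W) (hWL : W ^ 203 ≤ (L : ℝ)) (hLX : (L : ℝ) * W ^ 15 ≤ X)
    (hLexp : (L : ℝ) ≤ Real.exp (Real.sqrt (Real.log X / 2))) (hlogL : Real.log L ^ 5 ≤ W)
    (hsq : Real.sqrt (mid (κ * Real.log W - 48)) ≤ Cm * W ^ (-(5 : ℝ) / 4))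
    (hM : κ * Real.log W ≤ Sieve.nonpretentiousness g X W)
    (hjlow : 2 * (L : ℝ) / W ^ 2 < j) (hjup : (j : ℝ) ≤ 2 * L / d + 1) :
    ∀ d₀ : ℕ, 1 ≤ d₀ → d₀ ≤ q → ∀ q₀ : ℕ, 1 ≤ q₀ → q₀ ≤ q →
      ∀ χ : DirichletCharacter ℂ q₀, ∀ s' ∈ ({j / d₀, j / d₀ + 1} : Finset ℕ),
        winL1 (typFun (twistChar g χ) (W ^ 200) (L / W ^ 3) (Real.sqrt X₃) (X₃ / d / d₀)) s'
            (⌊X₃⌋₊ / d / d₀) ≤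
          (C₆ * (Cm + 1) * W ^ (-(5 : ℝ) / 4)) * s' * (X₃ / (d * d₀)) := by
  intro d₀ hd₀ hd₀q q₀ hq₀ hq₀q χ s' hs'
  -- basic facts
  have hW2 : (2 : ℝ) ≤ W := le_trans (by have := Real.add_one_le_exp (17 : ℝ); linarith) hW17
  have hW1 : (1 : ℝ) ≤ W := by linarith
  have hW0 : 0 < W := by linarith
  have hlogW : 17 ≤ Real.log W := by
    have := Real.log_le_log (Real.exp_pos _) hW17; rwa [Real.log_exp] at this
  have hL1 : (1 : ℝ) ≤ L := le_trans (one_le_pow₀ hW1) hWL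
  have hL0 : (0 : ℝ) < L := by linarith
  have hX1 : (1 : ℝ) ≤ X := by
    have : (1 : ℝ) * 1 ≤ (L : ℝ) * W ^ 15 := mul_le_mul hL1 (one_le_pow₀ hW1) zero_le_one hL0.le
    linarith
  have hX0 : 0 < X := by linarith
  have hd0 : (0 : ℝ) < d := by exact_mod_cast hd
  have hd1 : (1 : ℝ) ≤ d := by exact_mod_cast hd
  have hd₀0 : (0 : ℝ) < d₀ := by exact_mod_cast hd₀
  have hd₀W : (d₀ : ℝ) ≤ W := le_trans (by exact_mod_cast hd₀q) hqW
  have hq₀W : (q₀ : ℝ) ≤ W := le_trans (by exact_mod_cast hq₀q) hqW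
  set Mlow : ℝ := κ * Real.log W - 48 with hMlow
  have hMlow1 : 1 ≤ Mlow := by
    have h317 : (3 : ℝ) * 17 ≤ κ * Real.log W := mul_le_mul hκ hlogW (by norm_num) (by linarith)
    rw [hMlow]; linarith
  -- `d₁ = d d₀ < W²`
  have hd₁ : 1 ≤ d * d₀ := Nat.mul_le_mul hd hd₀
  have hd₁W : ((d * d₀ : ℕ) : ℝ) < W ^ 2 := by
    push_cast
    calc (d : ℝ) * d₀ < W * d₀ := mul_lt_mul_of_pos_right hdW hd₀0
      _ ≤ W * W := mul_le_mul_of_nonneg_left hd₀W hW0.le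
      _ = W ^ 2 := (sq W).symm
  -- the window length `s'`
  rw [Finset.mem_insert, Finset.mem_singleton] at hs'
  have hs'ge : (j : ℝ) / d₀ - 1 ≤ s' := by
    have h : (j : ℝ) / d₀ - 1 ≤ ((j / d₀ : ℕ) : ℝ) := by
      have hd₀0 : (0 : ℝ) < d₀ := by exact_mod_cast hd₀
      have h1 : (j : ℝ) < ((j / d₀ : ℕ) : ℝ) * d₀ + d₀ := by exact_mod_cast Nat.lt_div_mul_add hd₀
      have h2 : (j : ℝ) / d₀ < ((j / d₀ : ℕ) : ℝ) + 1 := by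
        rw [div_lt_iff₀ hd₀0]; linarith
      linarith
    rcases hs' with rfl | rfl
    · exact h
    · push_cast; linarith
  have hs'le : (s' : ℝ) ≤ j + 1 := by
    have h : ((j / d₀ : ℕ) : ℝ) ≤ j := by exact_mod_cast Nat.div_le_self j d₀
    rcases hs' with rfl | rfl
    · linarith
    · push_cast; linarith
  have hs'low : (L : ℝ) / W ^ 3 + 1 / 2 ≤ s' := by
    have h2 : 2 * ((L : ℝ) / W ^ 3) ≤ (j : ℝ) / d₀ := by
      rw [le_div_iff₀ hd₀0]
      calc 2 * ((L : ℝ) / W ^ 3) * d₀ ≤ 2 * (L / W ^ 3) * W := by gcongr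
        _ = 2 * L / W ^ 2 := by field_simp
        _ ≤ j := hjlow.le
    have h3 : (3 : ℝ) / 2 ≤ (L : ℝ) / W ^ 3 := by
      rw [le_div_iff₀ (by positivity)]
      calc 3 / 2 * W ^ 3 ≤ W * W ^ 3 := by gcongr; linarith
        _ = W ^ 4 := by ring
        _ ≤ W ^ 203 := pow_le_pow_right₀ hW1 (by norm_num)
        _ ≤ L := hWL
    linarith
  have hs'up : (s' : ℝ) ≤ 3 * L := by
    have h2 : 2 * (L : ℝ) / d ≤ 2 * L := div_le_self (by positivity) hd1
    have h3 : (2 : ℝ) ≤ L := by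
      have : (2 : ℝ) ≤ W ^ 203 := le_trans hW2 (le_self_pow₀ hW1 (by norm_num))
      exact this.trans hWL
    linarith
  -- non-pretentiousness at the dyadic heights
  have hlogX0 : 0 ≤ Real.log X := Real.log_nonneg hX1
  have hW125 : W ^ (125 : ℕ) ≤ Real.log X := by
    have h := Real.rpow_le_rpow hW0.le hWX (by norm_num : (0 : ℝ) ≤ 125)
    rw [← Real.rpow_mul hlogX0, show (1 / 125 : ℝ) * 125 = 1 by norm_num, Real.rpow_one,
      show (125 : ℝ) = (125 : ℕ) by norm_num, Real.rpow_natCast] at h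
    exact h
  have hW16 : (16 : ℝ) ≤ W := le_trans (by have := Real.add_one_le_exp (17 : ℝ); linarith) hW17
  have hX16 : 16 ≤ Real.log X := by
    have : (16 : ℝ) ≤ W ^ 125 := le_trans hW16 (le_self_pow₀ hW1 (by norm_num))
    exact this.trans hW125
  have hsqrtX : 2 * Real.log X ≤ Real.sqrt X := two_mul_log_le_sqrt hX0 hX16
  have hW12 : 4 * W ^ 12 ≤ Real.sqrt X := by
    have h1 : 4 * W ^ 12 ≤ W ^ 14 := by
      have h4 : (4 : ℝ) ≤ W ^ 2 := by nlinarith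
      calc 4 * W ^ 12 = W ^ 12 * 4 := by ring
        _ ≤ W ^ 12 * W ^ 2 := mul_le_mul_of_nonneg_left h4 (by positivity)
        _ = W ^ 14 := by ring
    have h2 : W ^ (14 : ℕ) ≤ Real.log X := le_trans (pow_le_pow_right₀ hW1 (by norm_num)) hW125
    linarith
  have hMd : ∀ Xb : ℝ, X₃ / (4 * ((d * d₀ : ℕ) : ℝ) * W ^ 10) ≤ Xb → Xb ≤ X →
      Mlow ≤ minPretentiousDistSq (twistChar g χ) Xb Xb := by
    intro Xb hXb1 hXb2
    have hsq : Real.sqrt X ≤ Xb := by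
      refine le_trans ?_ hXb1
      rw [le_div_iff₀ (by positivity)]
      calc Real.sqrt X * (4 * ((d * d₀ : ℕ) : ℝ) * W ^ 10) ≤ Real.sqrt X * (4 * W ^ 2 * W ^ 10) := by
            gcongr
        _ = Real.sqrt X * (4 * W ^ 12) := by ring
        _ ≤ Real.sqrt X * Real.sqrt X := by gcongr
        _ = X := Real.mul_self_sqrt hX0.le
        _ ≤ X₃ := hXX₃
    have hXb4 : 4 ≤ Xb := by
      have : (4 : ℝ) ≤ 4 * W ^ 12 := by nlinarith [one_le_pow₀ (n := 12) hW1]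
      linarith
    have := minPretentiousDistSq_twistChar_ge hg1 hq₀ χ hq₀W hXb4 hXb2 hsq
    rw [hMlow]; linarith
  -- apply the single-character estimate
  have hmain := h6 X X₃ W L (d * d₀) s' (twistChar g χ) Mlow (twistChar_mul hg χ) (twistChar_map_one hg1' χ)
    (norm_twistChar_le hg1 χ) hXs hXX₃ hX₃ hW₀ hWX hd₁ hd₁W hWL hLX hLexp hlogL hs'low hs'up hMlow1 hMd
  -- rewrite heights and floors
  have e1 : X₃ / d / d₀ = X₃ / ((d * d₀ : ℕ) : ℝ) := by push_cast; rw [div_div]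
  have e2 : ⌊X₃⌋₊ / d / d₀ = ⌊X₃ / ((d * d₀ : ℕ) : ℝ)⌋₊ := by
    rw [Nat.floor_div_natCast, Nat.div_div_eq_div_mul]
  rw [e1, e2]
  refine hmain.trans ?_
  have hX₃0 : 0 ≤ X₃ := by linarith
  have e3 : X₃ / ((d * d₀ : ℕ) : ℝ) = X₃ / (d * d₀) := by push_cast; ring
  rw [e3]
  have hpos : 0 ≤ C₆ * s' * (X₃ / (d * d₀)) := by positivity
  calc C₆ * s' * (X₃ / (d * d₀)) * (Real.sqrt (mid Mlow) + W ^ (-(5 : ℝ) / 4))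
      ≤ C₆ * s' * (X₃ / (d * d₀)) * (Cm * W ^ (-(5 : ℝ) / 4) + W ^ (-(5 : ℝ) / 4)) := by
        refine mul_le_mul_of_nonneg_left (add_le_add ?_ le_rfl) hpos
        rw [hMlow]; exact hsq
    _ = C₆ * (Cm + 1) * W ^ (-(5 : ℝ) / 4) * s' * (X₃ / (d * d₀)) := by ring


set_option maxHeartbeats 1600000 in
/-- **The major arc estimate, from the schema `TheoremA2With mid`** ([MRT2015, §4], the case `q ≤ W` of
Proposition 2.4), discrete form and with the `L²` minor-arc companion's normalisations: for `g` completely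
multiplicative and `1`-bounded with `M(g; X, W) ≥ κ log W` (the printed hypothesis (2-1) has `κ = 3`; here
`κ ≥ 3` and `√(mid(κ log W - 48)) ≤ C_m W^{-5/4}` for `W ≥ W₁` are parameters), `α = a/q + β` with `q ≤ W`,
`|β| ≤ W/(qL)`, scale `d < W`, heights `X ≤ X₃ ≤ 2X`, and the parameter regime of Theorem 2.3
(`W ≤ log^{1/125} X`; we also assume `L W^{15} ≤ X`, `L ≤ exp(√(log X/2))`, `(log L)⁵ ≤ W`,
`W^{203} ≤ L`, valid in the proof of Theorem 1.7),
`∑_{x ≤ X₃} |∑_{x < dm ≤ x + L, m ∈ 𝒮'} g(m) e(αm)| ≤ C L X₃ (W^{-2} + d^{-1} W^{-1/4})`,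
`𝒮' = 𝒮_{W^{200}, L/W³, √X₃, X₃/d}`.  Steps as printed: rescaling to windows of length
`⌊L/d⌋, ⌊L/d⌋+1`; removal of `e(βm)` by partial summation; windows shorter than `2L/W²` are trivial;
otherwise residue classes mod `q`, characters, and Theorem A.2 (`perChar_bound`); the proof of
`MRT2015.majorArc_le` verbatim. [cite: MatomakiRadziwillTao2015, §4] -/
theorem majorArc_le {mid : ℝ → ℝ} (hmid0 : ∀ M : ℝ, 0 ≤ M → 0 ≤ mid M)
    (hanti : ∀ a b : ℝ, 1 ≤ a → a ≤ b → mid b ≤ mid a) (hA2 : TheoremA2With mid)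
    {κ Cm W₁ : ℝ} (hκ : 3 ≤ κ) (hCm : 0 ≤ Cm)
    (hdecay : ∀ W : ℝ, W₁ ≤ W → Real.sqrt (mid (κ * Real.log W - 48)) ≤ Cm * W ^ (-(5 : ℝ) / 4)) :
    ∃ C W₀ Xs : ℝ, 0 < C ∧ ∀ (X X₃ W : ℝ) (L d q : ℕ) (a : ℤ) (α : ℝ) (g : ArithmeticFunction ℂ),
      (∀ m n : ℕ, g (m * n) = g m * g n) → g 1 = 1 → (∀ n, ‖g n‖ ≤ 1) →
      Xs ≤ X → X ≤ X₃ → X₃ ≤ 2 * X → W₀ ≤ W → W ≤ Real.log X ^ (1 / 125 : ℝ) →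
      1 ≤ d → (d : ℝ) < W → 1 ≤ q → (q : ℝ) ≤ W → |α - a / q| ≤ W / (q * L) →
      W ^ 203 ≤ (L : ℝ) → (L : ℝ) * W ^ 15 ≤ X → (L : ℝ) ≤ Real.exp (Real.sqrt (Real.log X / 2)) →
      Real.log L ^ 5 ≤ W → κ * Real.log W ≤ Sieve.nonpretentiousness g X W →
      ∑ x ∈ range (⌊X₃⌋₊ + 1), ‖∑ m ∈ Ioc (x / d) ((x + L) / d),
          typFun g (W ^ 200) (L / W ^ 3) (Real.sqrt X₃) (X₃ / d) m * (𝐞 (α * m) : ℂ)‖ ≤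
        C * L * X₃ * (1 / W ^ 2 + 1 / (d * W ^ (1 / 4 : ℝ))) := by
  obtain ⟨C₆, W₆, X₆, hC₆, h6⟩ := winL1_typical_le hmid0 hanti hA2
  set Cχ : ℝ := C₆ * (Cm + 1) with hCχ
  have hCχ0 : 0 < Cχ := by positivity
  refine ⟨8 + 16 * Cχ + 32 * π + 64 * π * Cχ, max W₆ (max (Real.exp 17) W₁), X₆, by positivity, ?_⟩
  intro X X₃ W L d q a α g hg hg1' hg1 hXs hXX₃ hX₃ hW₀ hWX hd hdW hq hqW hβ hWL hLX hLexp hlogL hM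
  -- basics
  have hW₆ : W₆ ≤ W := (le_max_left _ _).trans hW₀
  have hW17 : Real.exp 17 ≤ W := ((le_max_left _ _).trans (le_max_right _ _)).trans hW₀
  have hWW₁ : W₁ ≤ W := ((le_max_right _ _).trans (le_max_right _ _)).trans hW₀
  have hW18 : (18 : ℝ) ≤ W := le_trans (by have := Real.add_one_le_exp (17 : ℝ); linarith) hW17
  have hW1 : (1 : ℝ) ≤ W := by linarith
  have hW0 : 0 < W := by linarith
  have hd0 : (0 : ℝ) < d := by exact_mod_cast hd
  have hd1 : (1 : ℝ) ≤ d := by exact_mod_cast hd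
  have hq0 : (0 : ℝ) < q := by exact_mod_cast hq
  have hq1 : (1 : ℝ) ≤ q := by exact_mod_cast hq
  have hL1 : (1 : ℝ) ≤ L := le_trans (one_le_pow₀ hW1) hWL
  have hL0 : (0 : ℝ) < L := by linarith
  have hLW : W ≤ (L : ℝ) := le_trans (le_self_pow₀ hW1 (by norm_num)) hWL
  have hdL : (d : ℝ) ≤ L := (hdW.le).trans hLW
  have hX1 : (1 : ℝ) ≤ X := by
    have : (1 : ℝ) * 1 ≤ (L : ℝ) * W ^ 15 := mul_le_mul hL1 (one_le_pow₀ hW1) zero_le_one hL0.le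
    linarith
  have hXW : W ≤ X := by
    have : (1 : ℝ) * W ≤ (L : ℝ) * W ^ 15 :=
      mul_le_mul hL1 (le_self_pow₀ hW1 (by norm_num)) hW0.le hL0.le
    linarith
  have hX0 : 0 < X := by linarith
  have hX₃0 : 0 < X₃ := by linarith
  have hdX₃ : (d : ℝ) ≤ X₃ := by linarith [hdW.le]
  have hP : (1 : ℝ) < W ^ 200 := by
    calc (1 : ℝ) < W := by linarith
      _ ≤ W ^ 200 := le_self_pow₀ hW1 (by norm_num)
  have hqP : (q : ℝ) < W ^ 200 := lt_of_le_of_lt hqW (by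
    calc W = W ^ 1 := (pow_one W).symm
      _ < W ^ 200 := pow_lt_pow_right₀ (by linarith) (by norm_num))
  have hQ : 1 ≤ Real.log ((L : ℝ) / W ^ 3) := by
    have h1 : W ≤ (L : ℝ) / W ^ 3 := by
      rw [le_div_iff₀ (by positivity)]
      calc W * W ^ 3 = W ^ 4 := by ring
        _ ≤ W ^ 203 := pow_le_pow_right₀ hW1 (by norm_num)
        _ ≤ L := hWL
    have h2 : Real.exp 1 ≤ W := le_trans (Real.exp_le_exp.mpr (by norm_num)) hW17
    have := Real.log_le_log (Real.exp_pos 1) (h2.trans h1)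
    rwa [Real.log_exp] at this
  -- `W`-powers
  set v : ℝ := W ^ (1 / 4 : ℝ) with hv
  have hv0 : 0 < v := Real.rpow_pos_of_pos hW0 _
  have hvW : v ≤ W := by
    rw [hv]; calc W ^ (1 / 4 : ℝ) ≤ W ^ (1 : ℝ) := Real.rpow_le_rpow_of_exponent_le hW1 (by norm_num)
      _ = W := Real.rpow_one W
  have hK : W ^ (-(5 : ℝ) / 4) = 1 / (W * v) := by
    rw [hv, show (-(5 : ℝ) / 4) = -((5 : ℝ) / 4) by ring, Real.rpow_neg hW0.le,
      show ((5 : ℝ) / 4) = 1 + 1 / 4 by norm_num, Real.rpow_add hW0, Real.rpow_one, inv_eq_one_div]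
  set K : ℝ := Cχ * W ^ (-(5 : ℝ) / 4) with hKdef
  have hK0 : 0 ≤ K := by positivity
  -- the unit-scale family
  set Y : ℕ := ⌊X₃⌋₊ / d with hY
  have hYle : (Y : ℝ) ≤ X₃ / d := by
    rw [hY, le_div_iff₀ hd0]
    calc ((⌊X₃⌋₊ / d : ℕ) : ℝ) * d ≤ ⌊X₃⌋₊ := by exact_mod_cast Nat.div_mul_le_self _ _
      _ ≤ X₃ := Nat.floor_le hX₃0.le
  set c₀ : ℕ → ℂ := fun m =>
    typFun g (W ^ 200) (L / W ^ 3) (Real.sqrt X₃) (X₃ / d) m * (𝐞 ((a : ℝ) * m / q) : ℂ) with hc₀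
  have hc₀1 : ∀ m, ‖c₀ m‖ ≤ 1 := by
    intro m
    rw [hc₀]; dsimp only
    rw [norm_mul, norm_fourierChar, mul_one]
    exact norm_typFun_le hg1 _ _ _ _ m
  set Umax : ℝ := 4 * L * X₃ / (d * W ^ 2) + 8 * q * K * L * X₃ / (d : ℝ) ^ 2 with hUmax
  have hUmax0 : 0 ≤ Umax := by positivity
  have hU : ∀ j : ℕ, (j : ℝ) ≤ 2 * L / d + 1 → winL1 c₀ j Y ≤ Umax := by
    intro j hj
    by_cases hjs : (j : ℝ) ≤ 2 * L / W ^ 2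
    · -- short windows: trivial bound
      have h1 := winL1_le_trivial hc₀1 j Y
      refine h1.trans ?_
      have h2 : ((Y : ℝ) + 1) * j ≤ 4 * L * X₃ / (d * W ^ 2) := by
        calc ((Y : ℝ) + 1) * j ≤ (X₃ / d + X₃ / d) * (2 * L / W ^ 2) := by
              refine mul_le_mul (add_le_add hYle ?_) hjs (Nat.cast_nonneg j) (by positivity)
              rw [le_div_iff₀ hd0, one_mul]; exact hdX₃
          _ = 4 * L * X₃ / (d * W ^ 2) := by field_simp; ring
      have h3 : 0 ≤ 8 * q * K * L * X₃ / (d : ℝ) ^ 2 := by positivity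
      rw [hUmax]; linarith
    · -- long windows: residue classes and Theorem A.2
      rw [not_le] at hjs
      have hper := perChar_bound hκ hC₆ h6 hg hg1' hg1 hXs hXX₃ hX₃ hW₆ hW17 hWX hd hdW hqW hWL hLX
        hLexp hlogL (hdecay W hWW₁) hM hjs hj
      have h2 := unitScale_class_le hg hg1 hP hQ hX₃0.le hK0 hq hqP hd a hper
      refine h2.trans ?_
      have h3 : 2 * (j : ℝ) + 2 ≤ 8 * L / d := by
        have : (1 : ℝ) ≤ L / d := by rw [le_div_iff₀ hd0, one_mul]; exact hdL
        have e : 2 * (L : ℝ) / d = 2 * (L / d) := by ring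
        rw [e] at hj
        have e2 : 8 * (L : ℝ) / d = 8 * (L / d) := by ring
        rw [e2]; linarith
      have h4 : (q : ℝ) * K * X₃ * (2 * j + 2) / d ≤ (q : ℝ) * K * X₃ * (8 * L / d) / d :=
        div_le_div_of_nonneg_right (mul_le_mul_of_nonneg_left h3 (by positivity)) hd0.le
      refine h4.trans ?_
      have e : (q : ℝ) * K * X₃ * (8 * L / d) / d = 8 * q * K * L * X₃ / (d : ℝ) ^ 2 := by
        field_simp
      rw [e, hUmax]
      have : 0 ≤ 4 * (L : ℝ) * X₃ / (d * W ^ 2) := by positivity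
      linarith
  -- the two rescaled window lengths, with the twist removed
  set β : ℝ := α - a / q with hβdef
  have hfun : (fun m : ℕ => typFun g (W ^ 200) (L / W ^ 3) (Real.sqrt X₃) (X₃ / d) m * (𝐞 (α * m) : ℂ)) =
      fun m : ℕ => c₀ m * (𝐞 (β * m) : ℂ) := by
    funext m
    rw [hc₀]; dsimp only
    rw [mul_assoc, fourierChar_mul_fourierChar]
    congr 2
    rw [hβdef]; ring
  have hB : |β| ≤ W / (q * L) := hβ
  have hA : ∀ t : ℕ, (t : ℝ) ≤ L / d + 1 →
      winL1 (fun m : ℕ => c₀ m * (𝐞 (β * m) : ℂ)) t Y ≤ Umax * (1 + 4 * π * W / (q * d)) := by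
    intro t ht
    have h1 := winL1_twist_le c₀ hB t Y
    refine h1.trans ?_
    have ht2 : (t : ℝ) ≤ 2 * L / d := by
      have : (1 : ℝ) ≤ L / d := by rw [le_div_iff₀ hd0, one_mul]; exact hdL
      have e : 2 * (L : ℝ) / d = L / d + L / d := by ring
      rw [e]; linarith
    have hUt : winL1 c₀ t Y ≤ Umax := hU t (by linarith)
    have hsum : ∑ j ∈ range t, winL1 c₀ j Y ≤ t * Umax := by
      calc ∑ j ∈ range t, winL1 c₀ j Y ≤ ∑ j ∈ range t, Umax := by
            refine Finset.sum_le_sum fun j hj => hU j ?_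
            have : (j : ℝ) < t := by exact_mod_cast Finset.mem_range.mp hj
            linarith
        _ = t * Umax := by rw [Finset.sum_const, card_range, nsmul_eq_mul]
    have hWqL : 0 ≤ W / (q * L) := by positivity
    calc winL1 c₀ t Y + 2 * π * (W / (q * L)) * ∑ j ∈ range t, winL1 c₀ j Y
        ≤ Umax + 2 * π * (W / (q * L)) * (t * Umax) := by
          have := mul_le_mul_of_nonneg_left hsum (show 0 ≤ 2 * π * (W / (q * L)) by positivity)
          linarith
      _ ≤ Umax + 2 * π * (W / (q * L)) * (2 * L / d * Umax) := by
          have := mul_le_mul_of_nonneg_right ht2 hUmax0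
          have := mul_le_mul_of_nonneg_left this (show 0 ≤ 2 * π * (W / (q * L)) by positivity)
          linarith
      _ = Umax * (1 + 4 * π * W / (q * d)) := by field_simp; ring
  -- rescaling by `d`
  have hresc := sum_norm_win_div_le (fun m : ℕ => c₀ m * (𝐞 (β * m) : ℂ)) hd L ⌊X₃⌋₊
  rw [hfun]
  refine hresc.trans ?_
  have hLd : (((L / d : ℕ) : ℝ)) ≤ L / d := Nat.cast_div_le
  have hA1 := hA (L / d) (by linarith)
  have hA2' := hA (L / d + 1) (by push_cast; linarith)
  have htot : (d : ℝ) * (winL1 (fun m : ℕ => c₀ m * (𝐞 (β * m) : ℂ)) (L / d) (⌊X₃⌋₊ / d) +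
      winL1 (fun m : ℕ => c₀ m * (𝐞 (β * m) : ℂ)) (L / d + 1) (⌊X₃⌋₊ / d)) ≤
      d * (2 * (Umax * (1 + 4 * π * W / (q * d)))) := by
    refine mul_le_mul_of_nonneg_left ?_ hd0.le
    rw [← hY]; linarith
  refine htot.trans ?_
  -- final numerics
  rw [hUmax, hKdef, hK]
  have hT2 : (d : ℝ) * (2 * ((8 * q * (Cχ * (1 / (W * v))) * L * X₃ / (d : ℝ) ^ 2) * 1)) ≤
      16 * Cχ * L * X₃ / (d * v) := by
    have e : (d : ℝ) * (2 * ((8 * q * (Cχ * (1 / (W * v))) * L * X₃ / (d : ℝ) ^ 2) * 1)) =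
        16 * Cχ * L * X₃ / (d * v) * (q / W) := by field_simp; ring
    rw [e]
    have hqW' : (q : ℝ) / W ≤ 1 := (div_le_one hW0).mpr hqW
    have h0 : 0 ≤ 16 * Cχ * L * X₃ / (d * v) := by positivity
    nlinarith
  have hT3 : (d : ℝ) * (2 * ((4 * L * X₃ / (d * W ^ 2)) * (4 * π * W / (q * d)))) ≤
      32 * π * L * X₃ / (d * v) := by
    have e : (d : ℝ) * (2 * ((4 * L * X₃ / (d * W ^ 2)) * (4 * π * W / (q * d)))) =
        32 * π * L * X₃ / (d * v) * (v / (q * W)) := by field_simp; ring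
    rw [e]
    have h1 : v / (q * W) ≤ 1 := by
      rw [div_le_one (by positivity)]
      calc v ≤ W := hvW
        _ = 1 * W := (one_mul W).symm
        _ ≤ q * W := mul_le_mul_of_nonneg_right hq1 hW0.le
    have h0 : 0 ≤ 32 * π * L * X₃ / (d * v) := by positivity
    nlinarith
  have hT4 : (d : ℝ) * (2 * ((8 * q * (Cχ * (1 / (W * v))) * L * X₃ / (d : ℝ) ^ 2) * (4 * π * W / (q * d)))) ≤
      64 * π * Cχ * L * X₃ / (d * v) := by
    have e : (d : ℝ) * (2 * ((8 * q * (Cχ * (1 / (W * v))) * L * X₃ / (d : ℝ) ^ 2) * (4 * π * W / (q * d)))) =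
        64 * π * Cχ * L * X₃ / (d * v) * (1 / d) := by field_simp; ring
    rw [e]
    have h1 : 1 / (d : ℝ) ≤ 1 := (div_le_one hd0).mpr hd1
    have h0 : 0 ≤ 64 * π * Cχ * L * X₃ / (d * v) := by positivity
    nlinarith
  have hT1 : (d : ℝ) * (2 * ((4 * L * X₃ / (d * W ^ 2)) * 1)) = 8 * L * X₃ / W ^ 2 := by
    field_simp; ring
  -- expand the product
  have e : (d : ℝ) * (2 * ((4 * L * X₃ / (d * W ^ 2) + 8 * q * (Cχ * (1 / (W * v))) * L * X₃ / (d : ℝ) ^ 2) *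
      (1 + 4 * π * W / (q * d)))) =
      (d : ℝ) * (2 * ((4 * L * X₃ / (d * W ^ 2)) * 1)) +
      (d : ℝ) * (2 * ((8 * q * (Cχ * (1 / (W * v))) * L * X₃ / (d : ℝ) ^ 2) * 1)) +
      (d : ℝ) * (2 * ((4 * L * X₃ / (d * W ^ 2)) * (4 * π * W / (q * d)))) +
      (d : ℝ) * (2 * ((8 * q * (Cχ * (1 / (W * v))) * L * X₃ / (d : ℝ) ^ 2) * (4 * π * W / (q * d)))) := by
    ring
  rw [e, hT1]
  have hgoal : 8 * (L : ℝ) * X₃ / W ^ 2 + 16 * Cχ * L * X₃ / (d * v) + 32 * π * L * X₃ / (d * v) +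
      64 * π * Cχ * L * X₃ / (d * v) ≤
      (8 + 16 * Cχ + 32 * π + 64 * π * Cχ) * L * X₃ * (1 / W ^ 2 + 1 / (d * v)) := by
    have h1 : 0 ≤ (L : ℝ) * X₃ / W ^ 2 := by positivity
    have h2 : 0 ≤ (L : ℝ) * X₃ / (d * v) := by positivity
    have e2 : (8 + 16 * Cχ + 32 * π + 64 * π * Cχ) * L * X₃ * (1 / W ^ 2 + 1 / (d * v)) =
        (8 + 16 * Cχ + 32 * π + 64 * π * Cχ) * (L * X₃ / W ^ 2) +
        (8 + 16 * Cχ + 32 * π + 64 * π * Cχ) * (L * X₃ / (d * v)) := by ring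
    rw [e2]
    have e3 : 8 * (L : ℝ) * X₃ / W ^ 2 + 16 * Cχ * L * X₃ / (d * v) + 32 * π * L * X₃ / (d * v) +
        64 * π * Cχ * L * X₃ / (d * v) =
        8 * (L * X₃ / W ^ 2) + (16 * Cχ + 32 * π + 64 * π * Cχ) * (L * X₃ / (d * v)) := by ring
    rw [e3]
    have hπ : 0 ≤ π := Real.pi_pos.le
    nlinarith [mul_nonneg hCχ0.le h1, mul_nonneg hπ h1, mul_nonneg (mul_nonneg hπ hCχ0.le) h1,
      mul_nonneg hCχ0.le h2]
  linarith


end A2With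

end MRT2015

end Literature.NumberTheory.LFunctions
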